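import Literature.AlgebraicGeometry.Hu2025.Proofs.S05ThetaBlowups.Prop511
import Literature.AlgebraicGeometry.Hu2025.Statements.S05ThetaBlowups.R106dThetaEquations
/-!
# Hu 2025 §5.2 Prop. 5.11, bullet (3) — `D_{ϑ[k],L_F} ∩ 𝔙 = (L_{𝔙,F})`: the strict transform of an 𝔏-divisor along the word
# is the principal ideal of the pulled-back linearized relation — KERNEL DISCHARGE on the typed carrier, under the standing facts
# of the frame and UNIT SIGNS `sgn(s) = ±1`.

M-HU PREP by res-type-023 (gen 8), 2026-08-27 — FILED by res-type-055 (gen 9) as PARTITION-HU §3b HELPER for the row-106 owner res-type-023 (author of record; res-plan-2 IDLE POOL DEAL #4b 2026-08-27T08:54:38Z; helper TAKING 08:56:19Z, no objection) from the owner's deposited copy of record HOME/plan/tools/res-type-023/hu/file/Prop511L.lean sha16 92e9c1612279dbf2, UNCHANGED except this filing note; S files R106aCharts = p513406 · R106bThetaFrame = p516097 · R106cThetaBlowups = p518536 · R106dThetaEquations = p521266; Proofs chain Charts = p514775 · Prop511 = p519351; deposit rev 2 (extra import of R106dThetaEquations for Rem5_20_2, owner CONFIRMED (A) 09:48:56Z)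 (target `…/Proofs/S05ThetaBlowups/Prop511L.lean`, kind proof).
Nothing of [Hu25] asserted. Route (commutative algebra, any `R`): `L_{𝔙_[0],F_j} = ±x_ρ + h` with `x_ρ = x_{(u_{s_τ₀},v_{s_τ₀})}` a
non-leading ϱ-coordinate that is a variable of `𝔙_[0]` (exists: `𝔱_F ≥ 2`, at most one `≡ 1` coordinate per block) and `h` independent
of `x_ρ`; no ϑ-centre `{x_{u_i}, x_{(m,u_i)}}` contains `x_ρ`, so every pull-back keeps the shape `±x_ρ + h'` with `h'` independent of
`x_ρ`; for such `g` the substitution `x_ρ ↦ ∓(x_ρ − h')` is an `R`-algebra automorphism carrying `(g)` to `(x_ρ)`, which is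
`ζ`-saturated for every variable `ζ ≠ x_ρ` (`Charts`: `mem_span_X_of_mul_X_pow_mem`). AI work, weaker than expert review.
-/

noncomputable section

open MvPolynomial

namespace Literature.AlgebraicGeometry.Hu2025.Statements.S05ThetaBlowups

universe u v

variable {R : Type u} [CommRing R] {V : Type v}

/-! ## Polynomials independent of one variable; saturation of `(±x_ρ + h)` -/

section Indep

variable (ρ : V)

/-- «`h` does not involve the variable `x_ρ`»: substitutions agreeing off `ρ` agree on `h` (hypothesis form, no `vars`).
[cite: Hu2025, Prop. 5.11, pp. 86–88 (unrefereed preprint arXiv:2507.21400v1 under adjudication, D-0012/D-0089 — kernel support on OUR typed carrier of row 106; nothing of the source asserted)] -/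
def IndepVar (h : MvPolynomial V R) : Prop :=
  ∀ φ₁ φ₂ : V → MvPolynomial V R, (∀ v, v ≠ ρ → φ₁ v = φ₂ v) → aeval φ₁ h = aeval φ₂ h

variable {ρ}

/-- A variable other than `x_ρ` does not involve `x_ρ`. [cite: Hu2025, Prop. 5.11, pp. 86–88 (unrefereed preprint arXiv:2507.21400v1 under adjudication, D-0012/D-0089 — kernel support on OUR typed carrier of row 106; nothing of the source asserted)] -/
theorem indepVar_X {v : V} (hv : v ≠ ρ) : IndepVar (R := R) ρ (X v) := fun φ₁ φ₂ h => by
  simp [h v hv]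

/-- Constants do not involve `x_ρ`. [cite: Hu2025, Prop. 5.11, pp. 86–88 (unrefereed preprint arXiv:2507.21400v1 under adjudication, D-0012/D-0089 — kernel support on OUR typed carrier of row 106; nothing of the source asserted)] -/
theorem indepVar_C (a : R) : IndepVar ρ (C a : MvPolynomial V R) := fun φ₁ φ₂ _ => by simp

/-- `1` does not involve `x_ρ`. [cite: Hu2025, Prop. 5.11, pp. 86–88 (unrefereed preprint arXiv:2507.21400v1 under adjudication, D-0012/D-0089 — kernel support on OUR typed carrier of row 106; nothing of the source asserted)] -/
theorem indepVar_one : IndepVar ρ (1 : MvPolynomial V R) := fun φ₁ φ₂ _ => by simp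

/-- Sums of polynomials not involving `x_ρ` do not involve `x_ρ`. [cite: Hu2025, Prop. 5.11, pp. 86–88 (unrefereed preprint arXiv:2507.21400v1 under adjudication, D-0012/D-0089 — kernel support on OUR typed carrier of row 106; nothing of the source asserted)] -/
theorem IndepVar.add {p q : MvPolynomial V R} (hp : IndepVar ρ p) (hq : IndepVar ρ q) : IndepVar ρ (p + q) :=
  fun φ₁ φ₂ h => by rw [map_add, map_add, hp φ₁ φ₂ h, hq φ₁ φ₂ h]

/-- Products of polynomials not involving `x_ρ` do not involve `x_ρ`. [cite: Hu2025, Prop. 5.11, pp. 86–88 (unrefereed preprint arXiv:2507.21400v1 under adjudication, D-0012/D-0089 — kernel support on OUR typed carrier of row 106; nothing of the source asserted)] -/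
theorem IndepVar.mul {p q : MvPolynomial V R} (hp : IndepVar ρ p) (hq : IndepVar ρ q) : IndepVar ρ (p * q) :=
  fun φ₁ φ₂ h => by rw [map_mul, map_mul, hp φ₁ φ₂ h, hq φ₁ φ₂ h]

/-- Integer multiples of a polynomial not involving `x_ρ` do not involve `x_ρ`. [cite: Hu2025, Prop. 5.11, pp. 86–88 (unrefereed preprint arXiv:2507.21400v1 under adjudication, D-0012/D-0089 — kernel support on OUR typed carrier of row 106; nothing of the source asserted)] -/
theorem IndepVar.zsmul {p : MvPolynomial V R} (hp : IndepVar ρ p) (n : ℤ) : IndepVar ρ (n • p) :=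
  fun φ₁ φ₂ h => by rw [map_zsmul, map_zsmul, hp φ₁ φ₂ h]

/-- Finite sums of polynomials not involving `x_ρ` do not involve `x_ρ`. [cite: Hu2025, Prop. 5.11, pp. 86–88 (unrefereed preprint arXiv:2507.21400v1 under adjudication, D-0012/D-0089 — kernel support on OUR typed carrier of row 106; nothing of the source asserted)] -/
theorem IndepVar.sum {ι : Type*} (s : Finset ι) {p : ι → MvPolynomial V R} (hp : ∀ i ∈ s, IndepVar ρ (p i)) :
    IndepVar ρ (∑ i ∈ s, p i) := fun φ₁ φ₂ h => by
  rw [map_sum, map_sum]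
  exact Finset.sum_congr rfl fun i hi => hp i hi φ₁ φ₂ h

/-- A substitution fixing every variable other than `x_ρ` fixes a polynomial not involving `x_ρ`. [cite: Hu2025, Prop. 5.11, pp. 86–88 (unrefereed preprint arXiv:2507.21400v1 under adjudication, D-0012/D-0089 — kernel support on OUR typed carrier of row 106; nothing of the source asserted)] -/
theorem IndepVar.aeval_eq_self {p : MvPolynomial V R} (hp : IndepVar ρ p) {φ : V → MvPolynomial V R}
    (hφ : ∀ v, v ≠ ρ → φ v = X v) : aeval φ p = p := by
  rw [hp φ X hφ, aeval_X_left_apply]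

variable [DecidableEq V]

/-- **Saturation:** for `g = u • x_ρ + h`, `u = ±1`, `h` independent of `x_ρ`, and a variable `x_e ≠ x_ρ`:
`f · x_e ^ n ∈ (g) ⟹ f ∈ (g)` — over ANY commutative ring.
[cite: Hu2025, Prop. 5.11, pp. 86–88 (unrefereed preprint arXiv:2507.21400v1 under adjudication, D-0012/D-0089 — kernel support on OUR typed carrier of row 106; nothing of the source asserted)] -/
theorem mem_span_linear_of_mul_X_pow_mem {ρ e : V} (he : e ≠ ρ) {u : ℤ} (hu : u = 1 ∨ u = -1)
    {h : MvPolynomial V R} (hh : IndepVar ρ h) (n : ℕ) {f : MvPolynomial V R}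
    (hf : f * X e ^ n ∈ Ideal.span ({u • X ρ + h} : Set (MvPolynomial V R))) :
    f ∈ Ideal.span ({u • X ρ + h} : Set (MvPolynomial V R)) := by
  have huu : u * u = 1 := by rcases hu with rfl | rfl <;> norm_num
  set g : MvPolynomial V R := u • X ρ + h with hg
  -- β : x_ρ ↦ u • (x_ρ − h), α : x_ρ ↦ g, identity on the other variables
  let β : MvPolynomial V R →ₐ[R] MvPolynomial V R := aeval fun v => if v = ρ then u • (X ρ - h) else X v
  let α : MvPolynomial V R →ₐ[R] MvPolynomial V R := aeval fun v => if v = ρ then g else X v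
  have hβX : ∀ v, v ≠ ρ → β (X v) = X v := fun v hv => by simp [β, hv]
  have hαX : ∀ v, v ≠ ρ → α (X v) = X v := fun v hv => by simp [α, hv]
  have hβρ : β (X ρ) = u • (X ρ - h) := by simp [β]
  have hαρ : α (X ρ) = g := by simp [α]
  have hβh : β h = h := hh.aeval_eq_self fun v hv => by simp [hv]
  have hαh : α h = h := hh.aeval_eq_self fun v hv => by simp [hv]
  have hβg : β g = X ρ := by
    rw [hg, map_add, map_zsmul, hβρ, hβh, smul_smul, huu, one_smul, sub_add_cancel]
  have hαβ : ∀ p, α (β p) = p := by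
    intro p
    rw [← AlgHom.comp_apply]
    conv_rhs => rw [← AlgHom.id_apply (R := R) p]
    congr 1
    refine MvPolynomial.algHom_ext fun v => ?_
    by_cases hv : v = ρ
    · subst hv
      rw [AlgHom.comp_apply, hβρ, map_zsmul, map_sub, hαρ, hαh, AlgHom.id_apply, hg, add_sub_cancel_right, smul_smul,
        huu, one_smul]
    · rw [AlgHom.comp_apply, hβX v hv, hαX v hv, AlgHom.id_apply]
  -- transport
  have h1 : β (f * X e ^ n) ∈ (Ideal.span ({g} : Set (MvPolynomial V R))).map β := Ideal.mem_map_of_mem _ hf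
  rw [Ideal.map_span, Set.image_singleton, hβg, map_mul, map_pow, hβX e he] at h1
  have h2 : β f ∈ Ideal.span ({X ρ} : Set (MvPolynomial V R)) := mem_span_X_of_mul_X_pow_mem he n h1
  have h3 : α (β f) ∈ (Ideal.span ({X ρ} : Set (MvPolynomial V R))).map α := Ideal.mem_map_of_mem _ h2
  rwa [Ideal.map_span, Set.image_singleton, hαρ, hαβ] at h3

end Indep

variable [DecidableEq V]

/-! ## One step and a word on `(±x_ρ + h)` when no centre contains `x_ρ` -/

namespace ChartStep

variable (s : ChartStep V)

/-- `π^* x_ρ = x_ρ` for `x_ρ` outside the centre (Prop. 5.3 «y := y'»). [cite: Hu2025, Prop. 5.11, pp. 86–88 (unrefereed preprint arXiv:2507.21400v1 under adjudication, D-0012/D-0089 — kernel support on OUR typed carrier of row 106; nothing of the source asserted)] -/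
theorem pullback_X_of_not_mem' {ρ : V} (hρ : ρ ∉ s.centre) : s.pullback (R := R) (X ρ) = X ρ :=
  pullback_X_of_not_mem s hρ

/-- The pull-back keeps «independent of `x_ρ`» when `x_ρ` is not a centre coordinate.
[cite: Hu2025, Prop. 5.11, pp. 86–88 (unrefereed preprint arXiv:2507.21400v1 under adjudication, D-0012/D-0089 — kernel support on OUR typed carrier of row 106; nothing of the source asserted)] -/
theorem indepVar_pullback {ρ : V} (hρ : ρ ∉ s.centre) {h : MvPolynomial V R} (hh : IndepVar ρ h) :
    IndepVar ρ (s.pullback (R := R) h) := by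
  intro φ₁ φ₂ hφ
  unfold pullback
  rw [comp_aeval_apply, comp_aeval_apply]
  refine hh _ _ fun v hv => ?_
  have hexc : s.exc ≠ ρ := fun h' => hρ (h' ▸ s.exc_mem)
  by_cases hc : v ∈ s.centre ∧ v ≠ s.exc
  · rw [if_pos hc, map_mul, map_mul, aeval_X, aeval_X, aeval_X, aeval_X, hφ v hv, hφ s.exc hexc]
  · rw [if_neg hc, aeval_X, aeval_X, hφ v hv]

/-- The pull-back of `u·x_ρ + h` with `x_ρ` outside the centre is `u·x_ρ + π^* h`. [cite: Hu2025, Prop. 5.11, pp. 86–88 (unrefereed preprint arXiv:2507.21400v1 under adjudication, D-0012/D-0089 — kernel support on OUR typed carrier of row 106; nothing of the source asserted)] -/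
theorem pullback_linear {ρ : V} (hρ : ρ ∉ s.centre) (u : ℤ) (h : MvPolynomial V R) :
    s.pullback (R := R) (u • X ρ + h) = u • X ρ + s.pullback (R := R) h := by
  rw [map_add, map_zsmul, pullback_X_of_not_mem s hρ]

/-- One step: `strict((u x_ρ + h)) = (π^*(u x_ρ + h))`.
[cite: Hu2025, Prop. 5.11, pp. 86–88 (unrefereed preprint arXiv:2507.21400v1 under adjudication, D-0012/D-0089 — kernel support on OUR typed carrier of row 106; nothing of the source asserted)] -/
theorem strictTransform_span_linear {ρ : V} (hρ : ρ ∉ s.centre) {u : ℤ} (hu : u = 1 ∨ u = -1)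
    {h : MvPolynomial V R} (hh : IndepVar ρ h) :
    s.strictTransform (R := R) (Ideal.span {u • X ρ + h}) = Ideal.span {s.pullback (R := R) (u • X ρ + h)} := by
  unfold strictTransform
  rw [Ideal.map_span, Set.image_singleton, excVar_eq, pullback_linear s hρ]
  have hexc : s.exc ≠ ρ := fun h' => hρ (h' ▸ s.exc_mem)
  exact iSup_colon_pow_eq_self _ _ fun n f hf =>
    mem_span_linear_of_mul_X_pow_mem hexc hu (s.indepVar_pullback hρ hh) n hf

end ChartStep

namespace ChartSeq

/-- The composite pull-back along the empty word is the identity. [cite: Hu2025, Prop. 5.11, pp. 86–88 (unrefereed preprint arXiv:2507.21400v1 under adjudication, D-0012/D-0089 — kernel support on OUR typed carrier of row 106; nothing of the source asserted)] -/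
theorem pullback_nil (f : MvPolynomial V R) : ChartSeq.pullback (R := R) ([] : ChartSeq V) f = f := rfl

/-- Composite pull-back along `s :: w`: first `s`, then `w` (root first). [cite: Hu2025, Prop. 5.11, pp. 86–88 (unrefereed preprint arXiv:2507.21400v1 under adjudication, D-0012/D-0089 — kernel support on OUR typed carrier of row 106; nothing of the source asserted)] -/
theorem pullback_cons (s : ChartStep V) (w : ChartSeq V) (f : MvPolynomial V R) :
    ChartSeq.pullback (R := R) (s :: w) f = ChartSeq.pullback (R := R) w (s.pullback (R := R) f) := rfl

/-- Along a word none of whose centres contains `x_ρ`: `strict((u x_ρ + h)) = (π^*_w (u x_ρ + h))`.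
[cite: Hu2025, Prop. 5.11, pp. 86–88 (unrefereed preprint arXiv:2507.21400v1 under adjudication, D-0012/D-0089 — kernel support on OUR typed carrier of row 106; nothing of the source asserted)] -/
theorem strictTransform_span_linear (w : ChartSeq V) {ρ : V} (hρ : ∀ s ∈ w, ρ ∉ s.centre) {u : ℤ} (hu : u = 1 ∨ u = -1)
    {h : MvPolynomial V R} (hh : IndepVar ρ h) :
    ChartSeq.strictTransform R w (Ideal.span {u • X ρ + h}) =
      Ideal.span {ChartSeq.pullback (R := R) w (u • X ρ + h)} := by
  induction w generalizing h with
  | nil => rfl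
  | cons s w ih =>
    have hs : ρ ∉ s.centre := hρ s (by simp)
    rw [strictTransform_cons, ChartStep.strictTransform_span_linear s hs hu hh, ChartStep.pullback_linear s hs,
      pullback_cons, ChartStep.pullback_linear s hs]
    exact ih (fun s' hs' => hρ s' (by simp [hs'])) (s.indepVar_pullback hs hh)

end ChartSeq

/-! ## Bullet (3) of Prop. 5.11 on the frame -/

namespace ThetaFrame

variable {P : Type v} {Rs : Type v} [DecidableEq P] [DecidableEq Rs] (Φ : ThetaFrame P Rs)
variable (R : Type u) [CommRing R]

/-- No ϑ-centre of the word contains a non-leading ϱ-coordinate `x_{(u_s,v_s)}` (standing facts (iv) of the frame).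
[cite: Hu2025, Prop. 5.11, pp. 86–88 (unrefereed preprint arXiv:2507.21400v1 under adjudication, D-0012/D-0089 — kernel support on OUR typed carrier of row 106; nothing of the source asserted)] -/
theorem termR_not_mem_centre (hblk : ∀ k r, Φ.lead k = some r → Φ.blk r = k)
    (hterm : ∀ k τ r, Φ.termR k τ = some r → Φ.blk r = k ∧ Φ.lead k ≠ some r)
    {c : Φ.Chart} {a b : ℕ} {j : Fin Φ.N} {τ : Fin (Φ.t j)} {ρ : Rs} (hρ : Φ.termR j τ = some ρ) :
    ∀ s ∈ Φ.seq c a b, (Sum.inr ρ : P ⊕ Rs) ∉ s.centre := by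
  intro s hs hmem
  obtain ⟨i, -, hstep⟩ := Φ.mem_seq.mp hs
  cases hl : Φ.lead i with
  | none => rw [Φ.step_of_lead_none hl] at hstep; exact (Option.some_ne_none _ hstep.symm).elim
  | some r =>
    simp only [step, hl, Option.elim_some, Option.some.injEq] at hstep
    rw [← hstep] at hmem
    simp only [Finset.mem_insert, Finset.mem_singleton, reduceCtorEq, Sum.inr.injEq, false_or] at hmem
    subst hmem
    obtain ⟨hb, hne⟩ := hterm j τ ρ hρ
    have hi : i = j := (hblk i ρ hl).symm.trans hb
    subst hi
    exact hne hl

omit [DecidableEq P] [DecidableEq Rs] in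
/-- The chart value of an optional ϱ-coordinate different from `x_ρ` does not involve `x_ρ`. [cite: Hu2025, Prop. 5.11, pp. 86–88 (unrefereed preprint arXiv:2507.21400v1 under adjudication, D-0012/D-0089 — kernel support on OUR typed carrier of row 106; nothing of the source asserted)] -/
theorem indepVar_xOpt {ρ : Rs} (o : Option Rs) (ho : o ≠ some ρ) :
    IndepVar (Sum.inr ρ : P ⊕ Rs) (xOpt R o : MvPolynomial (P ⊕ Rs) R) := by
  cases o with
  | none => exact indepVar_one
  | some r =>
    simp only [xOpt, Option.elim_some]
    exact indepVar_X fun h => ho (by rw [Sum.inr_injective h])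

/-- **Prop. 5.11 bullet (3) on the typed carrier:** `D_{ϑ[k],L_{F_j}} ∩ 𝔙 = (L_{𝔙,F_j})` for every word and level, on a frame with
the standing facts (ii)–(iv) of `IsStandard` and unit signs `sgn(s) = ±1`.
[cite: Hu2025, Prop. 5.11, pp. 86–88 (unrefereed preprint arXiv:2507.21400v1 under adjudication, D-0012/D-0089 — kernel support on OUR typed carrier of row 106; nothing of the source asserted)] -/
theorem prop5_11_b3
    (ht : ∀ k, Φ.t k = 2 ∨ Φ.t k = 3)
    (hone : ∀ k, (Φ.lead k = none ∧ ∀ τ, Φ.termR k τ ≠ none) ∨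
        (Φ.lead k ≠ none ∧ ∃ τ₀, Φ.termR k τ₀ = none ∧ ∀ τ, τ ≠ τ₀ → Φ.termR k τ ≠ none))
    (hblk : ∀ k r, Φ.lead k = some r → Φ.blk r = k)
    (hterm : ∀ k τ r, Φ.termR k τ = some r → Φ.blk r = k ∧ Φ.lead k ≠ some r)
    (hinj : ∀ k τ τ' r, Φ.termR k τ = some r → Φ.termR k τ' = some r → τ = τ')
    (hsgn : ∀ k τ, Φ.sgnTerm k τ = 1 ∨ Φ.sgnTerm k τ = -1)
    (c : Φ.Chart) (k : ℕ) (j : Fin Φ.N) :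
    Φ.LDivAt R c k j = Ideal.span {Φ.linAt R c k j} := by
  -- a non-leading term of `F_j` whose ϱ-coordinate is a variable of `𝔙_[0]`
  obtain ⟨τ₀, ρ, hρ⟩ : ∃ (τ₀ : Fin (Φ.t j)) (ρ : Rs), Φ.termR j τ₀ = some ρ := by
    have h2 : 2 ≤ Φ.t j := by rcases ht j with h | h <;> omega
    rcases hone j with ⟨-, hall⟩ | ⟨-, τ₁, -, hall⟩
    · exact ⟨⟨0, by omega⟩, Option.ne_none_iff_exists'.mp (hall _)⟩
    · have : ∃ τ : Fin (Φ.t j), τ ≠ τ₁ := by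
        by_cases h0 : (τ₁ : ℕ) = 0
        · exact ⟨⟨1, by omega⟩, fun h => by simp [← h] at h0⟩
        · exact ⟨⟨0, by omega⟩, fun h => h0 (by simp [← h])⟩
      obtain ⟨τ, hτ⟩ := this
      exact ⟨τ, Option.ne_none_iff_exists'.mp (hall τ hτ)⟩
  -- `L = sgn(τ₀) • x_ρ + h` with `h` independent of `x_ρ`
  set h : MvPolynomial (P ⊕ Rs) R :=
    Φ.sgnLead j • xOpt R (Φ.lead j) + ∑ τ ∈ Finset.univ.erase τ₀, Φ.sgnTerm j τ • xOpt R (Φ.termR j τ) with hh_def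
  have hL : Φ.lin0 R j = Φ.sgnTerm j τ₀ • X (Sum.inr ρ) + h := by
    rw [hh_def, lin0, ← Finset.add_sum_erase _ _ (Finset.mem_univ τ₀), hρ]
    simp only [xOpt, Option.elim_some]
    abel
  have hh : IndepVar (Sum.inr ρ : P ⊕ Rs) h := by
    rw [hh_def]
    refine IndepVar.add (IndepVar.zsmul (indepVar_xOpt R _ fun hl => (hterm j τ₀ ρ hρ).2 hl) _)
      (IndepVar.sum _ fun τ hτ => IndepVar.zsmul (indepVar_xOpt R _ fun hτρ => ?_) _)
    exact (Finset.mem_erase.mp hτ).1 (hinj j τ τ₀ ρ hτρ hρ)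
  unfold LDivAt linAt proj
  rw [hL]
  exact ChartSeq.strictTransform_span_linear _ (Φ.termR_not_mem_centre hblk hterm hρ) (hsgn j τ₀) hh

/-- Bullet (3) from `IsStandard` (v3: conjunct (v) = unit signs).
[cite: Hu2025, Prop. 5.11, pp. 86–88 (unrefereed preprint arXiv:2507.21400v1 under adjudication, D-0012/D-0089 — kernel support on OUR typed carrier of row 106; nothing of the source asserted)] -/
theorem prop5_11_b3_of_isStandard (hstd : Φ.IsStandard) (c : Φ.Chart) (k : ℕ) (j : Fin Φ.N) :
    Φ.LDivAt R c k j = Ideal.span {Φ.linAt R c k j} :=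
  Φ.prop5_11_b3 R hstd.2.1 hstd.2.2.1 hstd.2.2.2.1 hstd.2.2.2.2.1 hstd.2.2.2.2.2.1 hstd.2.2.2.2.2.2.2 c k j

/-- **Proposition 5.11 AS TYPED (v3: all eight bullets, stated under the standing facts `Φ.IsStandard`) holds on EVERY frame,
every commutative ring, every word, every level.**
[cite: Hu2025, Prop. 5.11, pp. 86–88 (unrefereed preprint arXiv:2507.21400v1 under adjudication, D-0012/D-0089 — kernel support on OUR typed carrier of row 106; nothing of the source asserted)] -/
theorem Prop5_11_holds : Prop5_11 Φ R := fun hstd c k _ =>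
  ⟨fun w hw => Φ.prop5_11_b1 R c k w hw, fun r hr => Φ.prop5_11_b2 R c k r hr,
    fun j => Φ.prop5_11_b3_of_isStandard R hstd c k j, fun w hw => Φ.prop5_11_b4 R c k w hw,
    fun r hr => Φ.prop5_11_b5 R c k r hr, fun j w h => Φ.prop5_11_b6 R hstd.1 c k j w h,
    fun j r h => Φ.prop5_11_b7 R hstd.2.2.2.1 c k j r h, fun j h => Φ.prop5_11_b8 R c k j h⟩

/-! ## Two bookkeeping claims of rows 106b/106d (definitionally true) -/

omit [DecidableEq P] [DecidableEq Rs] in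
/-- C36L29–L32 «the order on 𝓑^gov coincides with the lexicographic order on Index_{𝓑^gov}» — AS TYPED (`ThetaFrame.C36L29`)
holds by definition of `Def5_7_govLT`.
[cite: Hu2025, Prop. 5.11, pp. 86–88 (unrefereed preprint arXiv:2507.21400v1 under adjudication, D-0012/D-0089 — kernel support on OUR typed carrier of row 106; nothing of the source asserted)] -/
theorem C36L29_holds : Φ.C36L29 := fun _ _ => Iff.rfl

omit [DecidableEq P] in
/-- Rem. 5.20, last sentences (`Rem5_20_2`): on a ϱ-standard chart at position `k`, `(m,u_k)` is labelled — AS TYPED, every frame.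
[cite: Hu2025, Prop. 5.11, pp. 86–88 (unrefereed preprint arXiv:2507.21400v1 under adjudication, D-0012/D-0089 — kernel support on OUR typed carrier of row 106; nothing of the source asserted)] -/
theorem Rem5_20_2_holds : Rem5_20_2 Φ := fun _ k _ hl hc =>
  Φ.mem_dSet.mpr ⟨k, Nat.lt_succ_self _, hl, hc⟩

/-! ## Typing note, kernel form: WITHOUT the standing facts the «unique label» clause fails on a degenerate frame
(two ϖ-steps at the same `u`) — the reason v3 of row 106c states `Prop5_11_labels` / `Prop5_11` under `Φ.IsStandard`. -/

/-- A degenerate toy frame: two blocks with the SAME leading ϖ-index.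
[cite: Hu2025, Prop. 5.11, pp. 86–88 (unrefereed preprint arXiv:2507.21400v1 under adjudication, D-0012/D-0089 — kernel support on OUR typed carrier of row 106; nothing of the source asserted)] -/
def toyDegenerate : ThetaFrame Unit Bool where
  N := 2
  t := fun _ => 2
  ult := fun _ => ()
  lead := fun k => some (decide (k.val = 0))
  termR := fun _ _ => none
  termP₁ := fun _ _ => ()
  termP₂ := fun _ _ => ()
  sgnLead := fun _ => 1
  sgnTerm := fun _ _ => 1
  blk := fun b => if b then 0 else 1
  rb := ∅

/-- The degenerate toy frame has two blocks. [cite: Hu2025, Prop. 5.11, pp. 86–88 (unrefereed preprint arXiv:2507.21400v1 under adjudication, D-0012/D-0089 — kernel support on OUR typed carrier of row 106; nothing of the source asserted)] -/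
theorem toyDegenerate_N : toyDegenerate.N = 2 := rfl

/-- On the degenerate toy frame both exceptional divisors of the all-ϖ word carry the same label — the kernel witness that the standing fact `u_k` distinct (C36L120) is needed for Prop. 5.11's «unique label». [cite: Hu2025, Prop. 5.11, pp. 86–88 (unrefereed preprint arXiv:2507.21400v1 under adjudication, D-0012/D-0089 — kernel support on OUR typed carrier of row 106; nothing of the source asserted)] -/
theorem toyDegenerate_labAt (j : Fin toyDegenerate.N) :
    toyDegenerate.labAt (fun _ => ThetaKind.varpi) 2 j = some (Sum.inl ()) := by
  have hj : j.val < 2 := toyDegenerate_N ▸ j.isLt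
  unfold labAt
  simp [hj, toyDegenerate]

/-- On `toyDegenerate` two DISTINCT ϖ-exceptional divisors carry the SAME label `u` on the all-ϖ chart of level 2: the
«distinct labels» clause (iii) of `Prop5_11_labels` cannot be stated without the standing facts of the frame.
[cite: Hu2025, Prop. 5.11, pp. 86–88 (unrefereed preprint arXiv:2507.21400v1 under adjudication, D-0012/D-0089 — kernel support on OUR typed carrier of row 106; nothing of the source asserted)] -/
theorem toyDegenerate_labels_clash :
    ∃ (c : toyDegenerate.Chart) (j₁ j₂ : Fin toyDegenerate.N) (l : Unit ⊕ Bool),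
      j₁ ≠ j₂ ∧ toyDegenerate.labAt c 2 j₁ = some l ∧ toyDegenerate.labAt c 2 j₂ = some l :=
  ⟨fun _ => ThetaKind.varpi, ⟨0, by decide⟩, ⟨1, by decide⟩, Sum.inl (),
    fun h => absurd (congrArg Fin.val h) (by decide), toyDegenerate_labAt _, toyDegenerate_labAt _⟩

/-- … and `toyDegenerate` is indeed not standard (`u_0 = u_1`).
[cite: Hu2025, Prop. 5.11, pp. 86–88 (unrefereed preprint arXiv:2507.21400v1 under adjudication, D-0012/D-0089 — kernel support on OUR typed carrier of row 106; nothing of the source asserted)] -/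
theorem not_isStandard_toyDegenerate : ¬ toyDegenerate.IsStandard := fun h =>
  absurd (congrArg Fin.val (@h.1 ⟨0, by decide⟩ ⟨1, by decide⟩ rfl)) (by decide)

end ThetaFrame

end Literature.AlgebraicGeometry.Hu2025.Statements.S05ThetaBlowups

end
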